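import Mathlib
import HarnessLib

/-!
# `stub_mnChebyshevMoments` — registered stub of line `FilterInvariance`
# (crux `EmbeddedDrudeMourre.GreenKuboContinuation`, item stmt-AtomisticToContinuum-12597)

Target `Summits/AtomisticToContinuum/FouriersLaw/Theorems/EmbeddedDrudeMourreGreenKuboContinuationMnChebyshevMoments.lean`
(`ledger propose --supports stmt-AtomisticToContinuum-12597`). The theorem name and signature of
`stub_mnChebyshevMoments` are REGISTERED and stay verbatim.

## Content

The Chebyshev moments of the semicircle weight `√(1 - x²)` on `[-1, 1]`:
`∫_{-1}^{1} T_m(x) √(1 - x²) dx = π/2, 0, -π/4, 0, 0, …` for `m = 0, 1, 2, ≥ 3`, stated as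
`π/2 · (1, 0, -1/2, 0, 0, …)`.

## Proof

Pointwise for every real `x`, `√(1 - x²) = (1 - x²) / √(1 - x²)` (`Real.div_sqrt`; both sides vanish
when `1 - x² ≤ 0`), and `1 - x² = (T_0(x) - T_2(x)) / 2`. Hence the interval integral is the integral
of `T_m · (T_0 - T_2) / 2` against Mathlib's `Polynomial.Chebyshev.measureT` (Lebesgue measure with
density `√(1 - x²)⁻¹` on `(-1, 1]`, `Polynomial.Chebyshev.integral_measureT`), and the orthogonality
relations of the Chebyshev `T` polynomials for `measureT`
(`integral_eval_T_real_mul_self_measureT_zero`, `integral_T_real_mul_self_measureT_of_ne_zero`,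
`integral_eval_T_real_mul_eval_T_real_measureT_of_ne`) give `(π - 0)/2`, `(0 - π/2)/2`, `(0 - 0)/2`
in the three cases `m = 0`, `m = 2`, `m ∉ {0, 2}`.
-/

noncomputable section

namespace Summit.AtomisticToContinuum.FouriersLaw.Theorems.GreenKuboContinuation.BandLimitedKrylov

open Filter Topology MeasureTheory Set Polynomial

namespace MnChebyshevMoments

open Polynomial.Chebyshev

/-- Pointwise, for every real `x`: `T_m(x) · √(1 - x²) = (T_m(x) · (1 - x²)) · √((1 - x²)⁻¹)`
(both sides vanish when `1 - x² ≤ 0`, since `Real.sqrt` of a nonpositive number is `0`; the weight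
of `Polynomial.Chebyshev.measureT` is literally `√((1 - x²)⁻¹) = (√(1 - x²))⁻¹`). [folklore] -/
theorem mnCheb_eval_mul_sqrt_eq (m : ℤ) (x : ℝ) :
    (T ℝ m).eval x * Real.sqrt (1 - x ^ 2) =
      (T ℝ m).eval x * (1 - x ^ 2) * Real.sqrt ((1 - x ^ 2)⁻¹) := by
  rw [Real.sqrt_inv, mul_assoc, ← div_eq_mul_inv, Real.div_sqrt]

/-- Pointwise, `T_m(x) · (1 - x²) = (T_m(x) T_0(x) - T_m(x) T_2(x)) / 2`
(`T_0 = 1`, `T_2 = 2X² - 1`). [folklore] -/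
theorem mnCheb_eval_mul_one_sub_sq_eq (m : ℤ) (x : ℝ) :
    (T ℝ m).eval x * (1 - x ^ 2) =
      ((T ℝ m).eval x * (T ℝ 0).eval x - (T ℝ m).eval x * (T ℝ 2).eval x) / 2 := by
  simp only [T_zero, T_two, eval_one, eval_sub, eval_mul, eval_ofNat, eval_pow, eval_X]
  ring

/-- The interval integral `∫_{-1}^{1} T_m(x) √(1 - x²) dx` as a combination of two `measureT`
inner products: `(⟪T_m, T_0⟫ - ⟪T_m, T_2⟫) / 2`. [folklore] -/
theorem mnCheb_intervalIntegral_eq (m : ℤ) :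
    ∫ x in (-1 : ℝ)..1, (T ℝ m).eval x * Real.sqrt (1 - x ^ 2) =
      ((∫ x, (T ℝ m).eval x * (T ℝ 0).eval x ∂measureT) -
        (∫ x, (T ℝ m).eval x * (T ℝ 2).eval x ∂measureT)) / 2 := by
  have h1 : ∫ x in (-1 : ℝ)..1, (T ℝ m).eval x * Real.sqrt (1 - x ^ 2) =
      ∫ x in (-1 : ℝ)..1, (T ℝ m).eval x * (1 - x ^ 2) * Real.sqrt ((1 - x ^ 2)⁻¹) :=
    intervalIntegral.integral_congr fun x _ => mnCheb_eval_mul_sqrt_eq m x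
  rw [h1, ← integral_measureT (fun x => (T ℝ m).eval x * (1 - x ^ 2))]
  simp_rw [mnCheb_eval_mul_one_sub_sq_eq]
  rw [MeasureTheory.integral_div, MeasureTheory.integral_sub
    (integrable_measureT (by fun_prop)) (integrable_measureT (by fun_prop))]

/-- `⟪T_m, T_0⟫_{measureT} = π` if `m = 0` and `0` otherwise (`m : ℕ`). [folklore] -/
theorem mnCheb_inner_T_zero (m : ℕ) :
    ∫ x, (T ℝ m).eval x * (T ℝ 0).eval x ∂measureT = if m = 0 then Real.pi else 0 := by
  by_cases hm : m = 0
  · subst hm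
    rw [if_pos rfl, Nat.cast_zero]
    exact integral_eval_T_real_mul_self_measureT_zero
  · rw [if_neg hm]
    have h := integral_eval_T_real_mul_eval_T_real_measureT_of_ne (n := m) (m := 0) hm
    rwa [Nat.cast_zero] at h

/-- `⟪T_m, T_2⟫_{measureT} = π / 2` if `m = 2` and `0` otherwise (`m : ℕ`). [folklore] -/
theorem mnCheb_inner_T_two (m : ℕ) :
    ∫ x, (T ℝ m).eval x * (T ℝ 2).eval x ∂measureT = if m = 2 then Real.pi / 2 else 0 := by
  by_cases hm : m = 2
  · subst hm
    rw [if_pos rfl, Nat.cast_ofNat]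
    exact integral_T_real_mul_self_measureT_of_ne_zero (n := 2) two_ne_zero
  · rw [if_neg hm]
    have h := integral_eval_T_real_mul_eval_T_real_measureT_of_ne (n := m) (m := 2) hm
    rwa [Nat.cast_ofNat] at h

end MnChebyshevMoments

open MnChebyshevMoments Polynomial.Chebyshev in
/-- **`stub_mnChebyshevMoments` — the Chebyshev moments of the semicircle weight.**
`∫_{-1}^{1} T_m(x) √(1 - x²) dx = π/2, 0, -π/4, 0, 0, …` (`m = 0, 1, 2, ≥ 3`):
`√(1-x²) = (1 - x²) · √(1-x²)⁻¹ = ½ (T_0 - T_2) · √(1-x²)⁻¹` pointwise on `ℝ`, and the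
orthogonality of `T_n` for Mathlib's `Polynomial.Chebyshev.measureT`. [folklore] -/
theorem stub_mnChebyshevMoments :
    ∀ m : ℕ, ∫ x in (-1 : ℝ)..1, (Polynomial.Chebyshev.T ℝ m).eval x * Real.sqrt (1 - x ^ 2) =
      Real.pi / 2 * (if m = 0 then 1 else if m = 2 then -(1 / 2) else 0) := by
  intro m
  rw [mnCheb_intervalIntegral_eq, mnCheb_inner_T_zero, mnCheb_inner_T_two]
  by_cases h0 : m = 0
  · have h2 : m ≠ 2 := by omega
    simp only [if_pos h0, if_neg h2]
    ring
  · by_cases h2 : m = 2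
    · simp only [if_neg h0, if_pos h2]
      ring
    · simp only [if_neg h0, if_neg h2]
      ring

end Summit.AtomisticToContinuum.FouriersLaw.Theorems.GreenKuboContinuation.BandLimitedKrylov

end
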